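import Summits.BirchSwinnertonDyer.Rank1Residual.P2.CMKolyvaginHabitatTamagawaCubeSums
import Literature.NumberTheory.EllipticCurves.MordellCurveKodairaThreeProofs
import Literature.NumberTheory.EllipticCurves.MordellCurveTamagawaIstarProofs
import Literature.NumberTheory.EllipticCurves.NeronComponentIndexTypeIIIProofs
import HarnessLib

/-!
# Route `CMKolyvaginAtInertTwo` (leaf `WAllCornerFTwo`): the TAMAGAWA binder of the habitat `H₂` on
# the WHOLE `j = 0` class — the parity of `∏_ℓ c_ℓ` for every Mordell curve `y² = x³ + k`, DECIDED

Cell `bsd-print-cf2` (run/shared/lean/pub/bsd-print-cf2/), seat ty2 (discharge interface), line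
`route-BirchSwinnertonDyer-CMKolyvaginAtInertTwo` (items stmt-BirchSwinnertonDyer-22835/22836,
residual 22838). HONEST FRAMING: THEOREMS ONLY — no definition, no named fact, no route file imported,
nothing about BSD asserted or booked; the leaf `Summit.BirchSwinnertonDyer.WAllCornerFTwo` is OPEN.

The habitat `H₂` of the line carries the binder `Odd W.tamagawaProduct`, and (lit g9, DOSSIER §20.5)
`H₂ ∩ leaf` consists of `j = 0` curves — every one of which is `y² = x³ + k` over `ℚ` — and the silent
quadratic twists of `j = −12288000`. The companion `CMKolyvaginHabitatTamagawaCubeSums` decided the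
binder on the cube sums (`k = −432n²`); this file decides it for EVERY `k ∈ ℤ ∖ {0}` and EVERY model
`W` (`C • W = (y² = x³ + k)`). With `a_p = v_p(k)` and `u_p = k / p^{a_p}`:

  **`Odd (∏_ℓ c_ℓ(W)) ⟺ ¬[a₂ ≡ 3 (mod 6) ∨ (a₂ ≡ 2 (mod 6) ∧ u₂ ≡ 3 (mod 4))]`**
  **`  ∧ ¬[a₃ ≡ 0 (mod 3) ∧ u₃ ≡ ±1 (mod 9)]`**
  **`  ∧ ∀ p ≥ 5, a_p ≡ 3 (mod 6) → u_p is a cubic non-residue mod p`**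

(`odd_tamagawaProduct_of_model_iff`). Place by place (Tate's algorithm in the kernel): at `2` (§1) the
tree's table `MordellCurveTateAlgorithmTwoProofs` gives good/II/IV/IV*/II* (`c` odd) off the two `I₀*`
rows, where `MordellCurveTamagawaIstarProofs` gives `2 ∣ c₂`; at `3` (§2) `MordellCurveKodairaThreeProofs`
(Rizzo's Table II = Tate) gives III/III* (`c = 2`) iff `a₃ ≡ 0 (3)`, `u₃ ≡ ±1 (9)`, else II/IV/IV*/II*;
at `p ≥ 5` (§3) X12's `hasGoodReductionAt_or_kodairaSymbolAt_of_mordell` gives good/II/IV/IV*/II* off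
`a_p ≡ 3 (6)`, where the type is `I₀*` with cubic `T³ + u_p`: `c = 1` without an `𝔽_p`-root, `2 ∣ c`
with one (`MordellCurveTamagawaIstarProofs`). The cube-sum criterion `n ≢ ±2 (mod 9)` of the companion
is the case `k = −432n²`. Numerical cross-check (EVIDENCE, not used): kit j295053 (PARI `elllocalred`,
`0 < |k| ≤ 3000`: 6000/6000 global and all local parities agree; 3466 `I₀*` rows `k = p³u`).

References: Silverman *ATAEC* IV.9.4, Table 4.1 [SilvermanATAEC1994]; Rizzo, Compositio 136 (2003)
Table II [Rizzo2003]; Boxer–Diao, Proc. AMS 138 (2010) proof of Prop. 4.1 [BoxerDiao2010].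
-/

set_option autoImplicit false

noncomputable section

open scoped Classical NumberField

open WeierstrassCurve NumberField IsDedekindDomain IsDedekindDomain.HeightOneSpectrum Rat.HeightOneSpectrum
  Literature.NumberTheory.EllipticCurves Literature.NumberTheory.EllipticCurves.Mordell
  Summit.BirchSwinnertonDyer.Rank1Residual.X12.CMRamifiedRecords Summit.BirchSwinnertonDyer.Rank1Residual.P2.CubeSum

namespace Summit.BirchSwinnertonDyer.Rank1Residual.P2.Mordell

/-! ## §0 Rescaling `y² = x³ + k` to `y² = x³ + p^{a mod 6}u` -/

section Rescale

variable {k : ℤ}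

/-- Rescaling `(q^m, 0, 0, 0) • (y² = x³ + q^{6m}·b) = (y² = x³ + b)`. [folklore] -/
theorem powScale_smul {q : ℚ} (hq : q ≠ 0) (m : ℕ) (b : ℚ) :
    (⟨Units.mk0 (q ^ m) (pow_ne_zero _ hq), 0, 0, 0⟩ : VariableChange ℚ) •
        (⟨0, 0, 0, 0, q ^ (6 * m) * b⟩ : WeierstrassCurve ℚ) = ⟨0, 0, 0, 0, b⟩ := by
  have h6 : (q ^ m) ^ 6 = q ^ (6 * m) := by rw [← pow_mul, mul_comm]
  ext <;> simp [WeierstrassCurve.variableChange_a₁, WeierstrassCurve.variableChange_a₂,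
    WeierstrassCurve.variableChange_a₃, WeierstrassCurve.variableChange_a₄,
    WeierstrassCurve.variableChange_a₆]
  rw [h6, inv_mul_cancel_left₀ (pow_ne_zero _ hq)]

/-- `k = p^{6⌊a/6⌋} · (p^{a mod 6} · u)` with `a = v_p(k)`, `u = k / pᵃ` (`k ≠ 0`), `p ∤ u`, `u ≠ 0`.
[folklore] -/
theorem eq_pow_mul_reduced {p : ℕ} (hp : p.Prime) (hk : k ≠ 0) :
    let a := k.natAbs.factorization p
    (k : ℚ) = (p : ℚ) ^ (6 * (a / 6)) * (((p : ℤ) ^ (a % 6) * (k / (p : ℤ) ^ a) : ℤ) : ℚ) ∧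
      ¬ (p : ℤ) ∣ k / (p : ℤ) ^ a ∧ k / (p : ℤ) ^ a ≠ 0 := by
  intro a
  have hdvd : (p : ℤ) ^ a ∣ k := by
    have : ((p ^ a : ℕ) : ℤ) ∣ k := Int.natCast_dvd.mpr (Nat.ordProj_dvd k.natAbs p)
    exact_mod_cast this
  obtain ⟨u, hu⟩ := hdvd
  have hpa : (p : ℤ) ^ a ≠ 0 := pow_ne_zero _ (by exact_mod_cast hp.ne_zero)
  have hdiv : k / (p : ℤ) ^ a = u := by rw [hu]; exact Int.mul_ediv_cancel_left _ hpa
  have hu0 : u ≠ 0 := by rintro rfl; exact hk (by rw [hu, mul_zero])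
  have hup : ¬ (p : ℤ) ∣ u := by
    rintro ⟨w, rfl⟩
    have h1 : (p : ℤ) ^ (a + 1) ∣ k := ⟨w, by rw [hu]; ring⟩
    have h2 : p ^ (a + 1) ∣ k.natAbs := by
      have := Int.natAbs_dvd_natAbs.mpr h1
      rwa [Int.natAbs_pow, Int.natAbs_natCast] at this
    have := (hp.pow_dvd_iff_le_factorization (Int.natAbs_ne_zero.mpr hk)).mp h2
    change a + 1 ≤ a at this
    omega
  refine ⟨?_, by rwa [hdiv], by rwa [hdiv]⟩
  rw [hdiv, hu]
  push_cast
  rw [← mul_assoc, ← pow_add, Nat.div_add_mod]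

/-- **Every model of `y² = x³ + k` is a model of the reduced equation `y² = x³ + p^{a mod 6}u`**
(`a = v_p(k)`, `u = k/pᵃ`). [folklore] -/
theorem exists_smul_eq_reduced {p : ℕ} (hp : p.Prime) (hk : k ≠ 0) (B : WeierstrassCurve ℚ)
    (hB : ∃ C : VariableChange ℚ, C • B = ⟨0, 0, 0, 0, (k : ℚ)⟩) :
    ∃ C : VariableChange ℚ, C • B =
      ⟨0, 0, 0, 0, (((p : ℤ) ^ (k.natAbs.factorization p % 6) *
        (k / (p : ℤ) ^ k.natAbs.factorization p) : ℤ) : ℚ)⟩ := by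
  obtain ⟨C, hC⟩ := hB
  obtain ⟨hkb, -, -⟩ := eq_pow_mul_reduced hp hk
  have hp0 : (p : ℚ) ≠ 0 := by exact_mod_cast hp.ne_zero
  refine ⟨⟨Units.mk0 ((p : ℚ) ^ (k.natAbs.factorization p / 6)) (pow_ne_zero _ hp0), 0, 0, 0⟩ * C,
    ?_⟩
  rw [mul_smul, hC, hkb, powScale_smul hp0]

end Rescale

/-! ## §1 The place over `2`: `c₂` is odd iff NOT (`a₂ ≡ 3 (mod 6)` or `a₂ ≡ 2 (mod 6) ∧ u₂ ≡ 3 (mod 4)`) -/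

section Two

variable {k : ℤ} (B : WeierstrassCurve ℚ) [B.IsElliptic] (v : HeightOneSpectrum (𝓞 ℚ))

/-- **Off the two `I₀*` rows, `y² = x³ + k` is good or of type II / IV / IV* / II* at `2`** (every
model; the tree's `2`-adic table on the reduced equation `y² = x³ + 2^{a mod 6}u`).
[cite: SilvermanATAEC1994, IV.9.4 (PDF pp. 344–346) and Table 4.1] -/
theorem good_or_kodairaSymbolAt_two_of_model (hk : k ≠ 0)
    (hB : ∃ C : VariableChange ℚ, C • B = ⟨0, 0, 0, 0, (k : ℚ)⟩) (hv : natGenerator v = 2)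
    (hno : ¬ (k.natAbs.factorization 2 % 6 = 3 ∨
      (k.natAbs.factorization 2 % 6 = 2 ∧ k / (2 : ℤ) ^ k.natAbs.factorization 2 % 4 = 3))) :
    B.HasGoodReductionAt v ∨ B.kodairaSymbolAt v = .II ∨ B.kodairaSymbolAt v = .IV ∨
      B.kodairaSymbolAt v = .IVstar ∨ B.kodairaSymbolAt v = .IIstar := by
  haveI : PerfectField (IsLocalRing.ResidueField (v.adicCompletionIntegers ℚ)) := PerfectField.ofFinite
  obtain ⟨C, hC⟩ := exists_smul_eq_reduced Nat.prime_two hk B hB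
  obtain ⟨-, hup, hu0⟩ := eq_pow_mul_reduced (k := k) Nat.prime_two hk
  simp only [Nat.cast_ofNat] at hC hup hu0
  set a := k.natAbs.factorization 2 with ha
  set u : ℤ := k / (2 : ℤ) ^ a with hu
  set M : WeierstrassCurve ℚ := ⟨0, 0, 0, 0, (((2 : ℤ) ^ (a % 6) * u : ℤ) : ℚ)⟩ with hMdef
  haveI : M.IsElliptic := by rw [← hC]; infer_instance
  have e₁ : M.a₁ = 0 := rfl; have e₂ : M.a₂ = 0 := rfl; have e₃ : M.a₃ = 0 := rfl
  have e₄ : M.a₄ = 0 := rfl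
  have hKW : B.kodairaSymbolAt v = M.kodairaSymbolAt v := by rw [← hC, kodairaSymbolAt_smul']
  have hGW : M.HasGoodReductionAt v → B.HasGoodReductionAt v := fun h => by
    rw [← hC] at h; exact (hasGoodReductionAt_smul_iff_holds v B C).mp h
  have hu4 : u % 4 = 1 ∨ u % 4 = 3 := by omega
  rcases (show a % 6 = 0 ∨ a % 6 = 1 ∨ a % 6 = 2 ∨ a % 6 = 3 ∨ a % 6 = 4 ∨ a % 6 = 5 by omega) with
    h0 | h1 | h2 | h3 | h4 | h5
  · have e₆ : M.a₆ = (u : ℚ) := by simp [hMdef, h0]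
    rcases hu4 with h41 | h43
    · exact Or.inr (Or.inr (Or.inl (by
        rw [hKW]
        exact (kodairaSymbolAt_and_ordMinimalDiscriminant_mordell_zero_of_emod_four_eq_one v hv M e₁ e₂
          e₃ e₄ h41 e₆).1)))
    · exact Or.inr (Or.inl (by
        rw [hKW]
        exact (kodairaSymbolAt_and_ordMinimalDiscriminant_mordell_zero_of_emod_four_eq_three v hv M e₁
          e₂ e₃ e₄ h43 e₆).1))
  · have e₆ : M.a₆ = ((2 * u : ℤ) : ℚ) := by simp [hMdef, h1]
    exact Or.inr (Or.inl (by
      rw [hKW]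
      exact (kodairaSymbolAt_and_ordMinimalDiscriminant_mordell_one v hv M e₁ e₂ e₃ e₄ hup e₆).1))
  · have e₆ : M.a₆ = ((4 * u : ℤ) : ℚ) := by simp [hMdef, h2]
    rcases hu4 with h41 | h43
    · exact Or.inr (Or.inr (Or.inr (Or.inl (by
        rw [hKW]
        exact (kodairaSymbolAt_and_ordMinimalDiscriminant_mordell_two_of_emod_four_eq_one v hv M e₁ e₂
          e₃ e₄ h41 e₆).1))))
    · exact absurd (Or.inr ⟨h2, h43⟩) hno
  · exact absurd (Or.inl h3) hno
  · have e₆ : M.a₆ = ((16 * u : ℤ) : ℚ) := by simp [hMdef, h4]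
    rcases hu4 with h41 | h43
    · exact Or.inl (hGW (hasGoodReductionAt_mordell_four_of_emod_four_eq_one v hv M e₁ e₂ e₃ e₄ h41 e₆))
    · exact Or.inr (Or.inr (Or.inr (Or.inr (by
        rw [hKW]
        exact (kodairaSymbolAt_and_ordMinimalDiscriminant_mordell_four_of_emod_four_eq_three v hv M e₁
          e₂ e₃ e₄ h43 e₆).1))))
  · have e₆ : M.a₆ = ((32 * u : ℤ) : ℚ) := by simp [hMdef, h5]
    exact Or.inr (Or.inr (Or.inr (Or.inr (by
      rw [hKW]
      exact (kodairaSymbolAt_and_ordMinimalDiscriminant_mordell_five v hv M e₁ e₂ e₃ e₄ hup e₆).1))))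

/-- Good / II / IV / IV* / II*: `c_v` is odd. [cite: SilvermanATAEC1994, IV.9.4 and Table 4.1] -/
theorem odd_localTamagawaNumber_of_good_or_II_IV_IVstar_IIstar
    (h : B.HasGoodReductionAt v ∨ B.kodairaSymbolAt v = .II ∨ B.kodairaSymbolAt v = .IV ∨
      B.kodairaSymbolAt v = .IVstar ∨ B.kodairaSymbolAt v = .IIstar) :
    Odd ((B.baseChange (v.adicCompletion ℚ)).localTamagawaNumber (v.adicCompletionIntegers ℚ)) := by
  rcases h with h | h | h | h | h
  · exact odd_localTamagawaNumber_of_hasGoodReductionAt B v h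
  · exact odd_localTamagawaNumber_of_kodairaSymbolAt_eq_II B v h
  · exact odd_localTamagawaNumber_of_kodairaSymbolAt_eq_IV B v h
  · exact odd_localTamagawaNumber_of_kodairaSymbolAt_eq_IVstar B v h
  · exact odd_localTamagawaNumber_of_kodairaSymbolAt_eq_IIstar B v h

/-- **`c₂(y² = x³ + k)` is ODD iff NOT (`v₂(k) ≡ 3 (mod 6)` or `v₂(k) ≡ 2 (mod 6) ∧ u₂ ≡ 3 (mod 4)`)**
(every model; `u₂ = k/2^{v₂(k)}`): off those rows good / II / IV / IV* / II*, on them `I₀*` with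
`2 ∣ c₂`. [cite: SilvermanATAEC1994, IV.9.4 Steps 3–10 and Table 4.1] -/
theorem odd_localTamagawaNumber_two_of_model_iff (hk : k ≠ 0)
    (hB : ∃ C : VariableChange ℚ, C • B = ⟨0, 0, 0, 0, (k : ℚ)⟩) (hv : natGenerator v = 2) :
    Odd ((B.baseChange (v.adicCompletion ℚ)).localTamagawaNumber (v.adicCompletionIntegers ℚ)) ↔
      ¬ (k.natAbs.factorization 2 % 6 = 3 ∨
        (k.natAbs.factorization 2 % 6 = 2 ∧ k / (2 : ℤ) ^ k.natAbs.factorization 2 % 4 = 3)) := by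
  obtain ⟨C, hC⟩ := hB
  constructor
  · intro hodd hrow
    rcases hrow with h3 | ⟨h2, hu⟩
    · exact (Nat.not_even_iff_odd.mpr hodd)
        (even_iff_two_dvd.mpr (two_dvd_localTamagawaNumber_mordell_two_of_three B v hC hk hv h3))
    · exact (Nat.not_even_iff_odd.mpr hodd)
        (even_iff_two_dvd.mpr (two_dvd_localTamagawaNumber_mordell_two_of_two B v hC hk hv h2 hu))
  · intro hno
    exact odd_localTamagawaNumber_of_good_or_II_IV_IVstar_IIstar B v
      (good_or_kodairaSymbolAt_two_of_model B v hk ⟨C, hC⟩ hv hno)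

end Two

/-! ## §2 The place over `3`: `c₃` is odd iff NOT (`a₃ ≡ 0 (mod 3)` and `u₃ ≡ ±1 (mod 9)`) -/

section Three

variable {k : ℤ} (B : WeierstrassCurve ℚ) [B.IsElliptic] (v : HeightOneSpectrum (𝓞 ℚ))

/-- Type `III`: `c_v = 2`. [cite: SilvermanATAEC1994, IV.9.4 Step 4 (PDF p. 344)] -/
theorem localTamagawaNumber_eq_two_of_kodairaSymbolAt_eq_III (h : B.kodairaSymbolAt v = .III) :
    (B.baseChange (v.adicCompletion ℚ)).localTamagawaNumber (v.adicCompletionIntegers ℚ) = 2 := by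
  haveI : PerfectField (IsLocalRing.ResidueField (v.adicCompletionIntegers ℚ)) := PerfectField.ofFinite
  exact localTamagawaNumber_eq_two_of_kodairaSymbolAt_eq_III_holds v B h

/-- **`c₃(y² = x³ + k)` is ODD iff NOT (`v₃(k) ≡ 0 (mod 3)` and `u₃ ≡ ±1 (mod 9)`)** (every model;
`u₃ = k/3^{v₃(k)}`): on that set the type is III / III* (`c₃ = 2`), off it II / IV / IV* / II*.
[cite: Rizzo2003, Table II (p. 4)] [cite: SilvermanATAEC1994, IV.9.4 and Table 4.1] -/
theorem odd_localTamagawaNumber_three_of_model_iff (hk : k ≠ 0)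
    (hB : ∃ C : VariableChange ℚ, C • B = ⟨0, 0, 0, 0, (k : ℚ)⟩) (hv : natGenerator v = 3) :
    Odd ((B.baseChange (v.adicCompletion ℚ)).localTamagawaNumber (v.adicCompletionIntegers ℚ)) ↔
      ¬ (k.natAbs.factorization 3 % 3 = 0 ∧
        (k / 3 ^ k.natAbs.factorization 3 % 9 = 1 ∨ k / 3 ^ k.natAbs.factorization 3 % 9 = 8)) := by
  obtain ⟨C, hC⟩ := hB
  obtain ⟨hsp, hnsp⟩ := kodairaSymbolAt_three_of_mordell_cases B v hC hk hv
  constructor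
  · intro hodd hrow
    have h2 : (B.baseChange (v.adicCompletion ℚ)).localTamagawaNumber (v.adicCompletionIntegers ℚ) = 2 := by
      rcases hsp hrow with h | h
      · exact localTamagawaNumber_eq_two_of_kodairaSymbolAt_eq_III B v h
      · exact localTamagawaNumber_eq_two_of_kodairaSymbolAt_eq_IIIstar B v h
    rw [h2] at hodd
    exact (Nat.not_even_iff_odd.mpr hodd) (by decide)
  · intro hno
    exact odd_localTamagawaNumber_of_good_or_II_IV_IVstar_IIstar B v (Or.inr (hnsp hno))

end Three

/-! ## §3 The places over `p ≥ 5`: `c_p` is odd iff (`a_p ≡ 3 (mod 6)` ⇒ `u_p` is not a cube mod `p`) -/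

section OddPrime

variable {k : ℤ} (B : WeierstrassCurve ℚ) [B.IsElliptic] (v : HeightOneSpectrum (𝓞 ℚ))

/-- **Off `v_p(k) ≡ 3 (mod 6)`, `y² = x³ + k` is good or of type II / IV / IV* / II* at `p ≥ 5`**
(every model; X12's engine `hasGoodReductionAt_or_kodairaSymbolAt_of_mordell`).
[cite: SilvermanATAEC1994, IV.9.4 Steps 1–10 and Table 4.1] -/
theorem good_or_kodairaSymbolAt_of_model_of_five_le (hk : k ≠ 0)
    (hB : ∃ C : VariableChange ℚ, C • B = ⟨0, 0, 0, 0, (k : ℚ)⟩) (hv5 : 5 ≤ natGenerator v)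
    (ha : k.natAbs.factorization (natGenerator v) % 6 ≠ 3) :
    B.HasGoodReductionAt v ∨ B.kodairaSymbolAt v = .II ∨ B.kodairaSymbolAt v = .IV ∨
      B.kodairaSymbolAt v = .IVstar ∨ B.kodairaSymbolAt v = .IIstar := by
  obtain ⟨C, hC⟩ := hB
  obtain ⟨hgood, hbad⟩ :=
    hasGoodReductionAt_or_kodairaSymbolAt_of_mordell B v hC hk (by omega) (by omega)
  set a := k.natAbs.factorization (natGenerator v) with hadef
  by_cases h0 : a % 6 = 0
  · exact Or.inl (hgood h0)
  have h := hbad h0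
  rcases (show a % 6 = 1 ∨ a % 6 = 2 ∨ a % 6 = 4 ∨ a % 6 = 5 by omega) with h1 | h1 | h1 | h1 <;>
    simp only [h1] at h
  · exact Or.inr (Or.inl h)
  · exact Or.inr (Or.inr (Or.inl h))
  · exact Or.inr (Or.inr (Or.inr (Or.inl h)))
  · exact Or.inr (Or.inr (Or.inr (Or.inr h)))

/-- **`c_p(y² = x³ + k)` at `p ≥ 5` is ODD iff (`v_p(k) ≡ 3 (mod 6)` ⇒ `u_p = k/p^{v_p(k)}` is a cubic
non-residue mod `p`)** (every model): off `a_p ≡ 3` good / II / IV / IV* / II*; on it `I₀*` with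
cubic `T³ + u_p`, `c = 1` without an `𝔽_p`-root, `2 ∣ c` with one.
[cite: SilvermanATAEC1994, IV.9.4 Step 6 (PDF p. 345) and Table 4.1] -/
theorem odd_localTamagawaNumber_of_model_iff_of_five_le (hk : k ≠ 0)
    (hB : ∃ C : VariableChange ℚ, C • B = ⟨0, 0, 0, 0, (k : ℚ)⟩) (hv5 : 5 ≤ natGenerator v) :
    Odd ((B.baseChange (v.adicCompletion ℚ)).localTamagawaNumber (v.adicCompletionIntegers ℚ)) ↔
      (k.natAbs.factorization (natGenerator v) % 6 = 3 →
        ¬ ∃ s : ZMod (natGenerator v),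
          s ^ 3 = ((k / (natGenerator v : ℤ) ^ k.natAbs.factorization (natGenerator v) : ℤ) :
            ZMod (natGenerator v))) := by
  obtain ⟨C, hC⟩ := hB
  have h2 : natGenerator v ≠ 2 := by omega
  have h3 : natGenerator v ≠ 3 := by omega
  constructor
  · intro hodd ha hs
    exact (Nat.not_even_iff_odd.mpr hodd)
      (even_iff_two_dvd.mpr (two_dvd_localTamagawaNumber_mordell_of_cube B v hC hk h2 h3 ha hs))
  · intro h
    by_cases ha : k.natAbs.factorization (natGenerator v) % 6 = 3
    · rw [localTamagawaNumber_mordell_eq_one_of_not_cube B v hC hk h2 h3 ha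
        (fun s hs => h ha ⟨s, hs⟩)]
      exact odd_one
    · exact odd_localTamagawaNumber_of_good_or_II_IV_IVstar_IIstar B v
        (good_or_kodairaSymbolAt_of_model_of_five_le B v hk ⟨C, hC⟩ hv5 ha)

end OddPrime

/-! ## §4 The Tamagawa binder on the whole `j = 0` class -/

section Assembly

variable {k : ℤ} (B : WeierstrassCurve ℚ) [B.IsElliptic]

/-- The place of `ℚ` over a prime `p`. [folklore] -/
theorem exists_place_natGenerator_eq {p : ℕ} (hp : p.Prime) :
    ∃ v : HeightOneSpectrum (𝓞 ℚ), natGenerator v = p :=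
  ⟨(primesEquiv (R := 𝓞 ℚ)).symm ⟨p, hp⟩, by
    show ((primesEquiv ((primesEquiv (R := 𝓞 ℚ)).symm ⟨p, hp⟩) : Nat.Primes) : ℕ) = p; simp⟩

/-- **THE TAMAGAWA BINDER ON THE `j = 0` CLASS.** For `k ∈ ℤ ∖ {0}` and EVERY model `B` of the
Mordell curve `y² = x³ + k` (`∃ C, C • B = (y² = x³ + k)`), with `a_p = v_p(k)`, `u_p = k/p^{a_p}`:
`Odd (∏_ℓ c_ℓ(B)) ⟺ ¬[a₂ ≡ 3 (6) ∨ (a₂ ≡ 2 (6) ∧ u₂ ≡ 3 (4))] ∧ ¬[a₃ ≡ 0 (3) ∧ u₃ ≡ ±1 (9)]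
∧ ∀ p ≥ 5, a_p ≡ 3 (6) → u_p is a cubic non-residue mod p`.
[cite: SilvermanATAEC1994, IV.9.4 and Table 4.1] [cite: Rizzo2003, Table II (p. 4)]
[cite: BoxerDiao2010, proof of Prop. 4.1 (p. 1977)] -/
theorem odd_tamagawaProduct_of_model_iff (hk : k ≠ 0)
    (hB : ∃ C : VariableChange ℚ, C • B = ⟨0, 0, 0, 0, (k : ℚ)⟩) :
    Odd B.tamagawaProduct ↔
      (¬ (k.natAbs.factorization 2 % 6 = 3 ∨
          (k.natAbs.factorization 2 % 6 = 2 ∧ k / (2 : ℤ) ^ k.natAbs.factorization 2 % 4 = 3)) ∧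
        ¬ (k.natAbs.factorization 3 % 3 = 0 ∧
          (k / 3 ^ k.natAbs.factorization 3 % 9 = 1 ∨ k / 3 ^ k.natAbs.factorization 3 % 9 = 8)) ∧
        ∀ p : ℕ, p.Prime → 5 ≤ p → k.natAbs.factorization p % 6 = 3 →
          ¬ ∃ s : ZMod p, s ^ 3 = ((k / (p : ℤ) ^ k.natAbs.factorization p : ℤ) : ZMod p)) := by
  rw [odd_tamagawaProduct_iff B]
  constructor
  · intro h
    refine ⟨?_, ?_, fun p hp hp5 ha => ?_⟩
    · obtain ⟨v, hv⟩ := exists_place_natGenerator_eq Nat.prime_two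
      exact (odd_localTamagawaNumber_two_of_model_iff B v hk hB hv).mp (h v)
    · obtain ⟨v, hv⟩ := exists_place_natGenerator_eq Nat.prime_three
      exact (odd_localTamagawaNumber_three_of_model_iff B v hk hB hv).mp (h v)
    · obtain ⟨v, hv⟩ := exists_place_natGenerator_eq hp
      subst hv
      exact (odd_localTamagawaNumber_of_model_iff_of_five_le B v hk hB hp5).mp (h v) ha
  · rintro ⟨h2, h3, h5⟩ v
    rcases natGenerator_cases v with hv | hv | hv
    · exact (odd_localTamagawaNumber_two_of_model_iff B v hk hB hv).mpr h2
    · exact (odd_localTamagawaNumber_three_of_model_iff B v hk hB hv).mpr h3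
    · exact (odd_localTamagawaNumber_of_model_iff_of_five_le B v hk hB hv).mpr
        (h5 _ (prime_natGenerator v) hv)

/-- **The binder FAILS at `2`:** `v₂(k) ≡ 3 (mod 6)`, or `v₂(k) ≡ 2 (mod 6)` with `u₂ ≡ 3 (mod 4)`,
makes `∏ c_ℓ` EVEN for every model of `y² = x³ + k` (type `I₀*` at `2`, `c₂ = 2`).
[cite: SilvermanATAEC1994, IV.9.4 Step 6 and Table 4.1] -/
theorem not_odd_tamagawaProduct_of_model_of_two (hk : k ≠ 0)
    (hB : ∃ C : VariableChange ℚ, C • B = ⟨0, 0, 0, 0, (k : ℚ)⟩)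
    (h : k.natAbs.factorization 2 % 6 = 3 ∨
      (k.natAbs.factorization 2 % 6 = 2 ∧ k / (2 : ℤ) ^ k.natAbs.factorization 2 % 4 = 3)) :
    ¬ Odd B.tamagawaProduct := fun hodd =>
  ((odd_tamagawaProduct_of_model_iff B hk hB).mp hodd).1 h

/-- **The binder FAILS at `3`:** `v₃(k) ≡ 0 (mod 3)` with `u₃ ≡ ±1 (mod 9)` makes `∏ c_ℓ` EVEN for
every model of `y² = x³ + k` (type III / III* at `3`, `c₃ = 2`; e.g. the cube sums `n ≡ ±2 (mod 9)`).
[cite: Rizzo2003, Table II (p. 4)] [cite: SilvermanATAEC1994, IV.9.4 Steps 4, 9 and Table 4.1] -/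
theorem not_odd_tamagawaProduct_of_model_of_three (hk : k ≠ 0)
    (hB : ∃ C : VariableChange ℚ, C • B = ⟨0, 0, 0, 0, (k : ℚ)⟩)
    (h : k.natAbs.factorization 3 % 3 = 0 ∧
      (k / 3 ^ k.natAbs.factorization 3 % 9 = 1 ∨ k / 3 ^ k.natAbs.factorization 3 % 9 = 8)) :
    ¬ Odd B.tamagawaProduct := fun hodd =>
  ((odd_tamagawaProduct_of_model_iff B hk hB).mp hodd).2.1 h

/-- **The binder FAILS at a prime `p ≥ 5`:** `v_p(k) ≡ 3 (mod 6)` with `u_p` a cube mod `p` (always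
the case for `p ≡ 2 (mod 3)`) makes `∏ c_ℓ` EVEN for every model of `y² = x³ + k` (type `I₀*` at `p`,
`c_p ∈ {2, 4}`). [cite: SilvermanATAEC1994, IV.9.4 Step 6 and Table 4.1] -/
theorem not_odd_tamagawaProduct_of_model_of_five_le (hk : k ≠ 0)
    (hB : ∃ C : VariableChange ℚ, C • B = ⟨0, 0, 0, 0, (k : ℚ)⟩) {p : ℕ} (hp : p.Prime)
    (hp5 : 5 ≤ p) (ha : k.natAbs.factorization p % 6 = 3)
    (hs : ∃ s : ZMod p, s ^ 3 = ((k / (p : ℤ) ^ k.natAbs.factorization p : ℤ) : ZMod p)) :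
    ¬ Odd B.tamagawaProduct := fun hodd =>
  ((odd_tamagawaProduct_of_model_iff B hk hB).mp hodd).2.2 p hp hp5 ha hs

/-- **The binder MET on the generic locus:** if `v₂(k) mod 6 ∉ {2, 3}`, `v₃(k) mod 3 ≠ 0` and no
prime `p ≥ 5` has `v_p(k) ≡ 3 (mod 6)` (e.g. `k` cube-free with `v₂(k) ≠ 2` and `3 ∣ k`… or any `k`
whose exponents avoid these classes), then `∏ c_ℓ` is ODD for every model of `y² = x³ + k` — no
residue condition is needed. [cite: SilvermanATAEC1994, IV.9.4 and Table 4.1] -/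
theorem odd_tamagawaProduct_of_model_of_exponents (hk : k ≠ 0)
    (hB : ∃ C : VariableChange ℚ, C • B = ⟨0, 0, 0, 0, (k : ℚ)⟩)
    (h2 : k.natAbs.factorization 2 % 6 ≠ 2 ∧ k.natAbs.factorization 2 % 6 ≠ 3)
    (h3 : k.natAbs.factorization 3 % 3 ≠ 0)
    (h5 : ∀ p : ℕ, p.Prime → 5 ≤ p → k.natAbs.factorization p % 6 ≠ 3) :
    Odd B.tamagawaProduct := by
  refine (odd_tamagawaProduct_of_model_iff B hk hB).mpr ⟨?_, ?_, fun p hp hp5 ha => ?_⟩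
  · rintro (h | ⟨h, -⟩)
    · exact h2.2 h
    · exact h2.1 h
  · rintro ⟨h, -⟩; exact h3 h
  · exact absurd ha (h5 p hp hp5)

end Assembly

end Summit.BirchSwinnertonDyer.Rank1Residual.P2.Mordell

end
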